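import Literature.MathematicalPhysics.QuantumFieldTheory.Federbush1986.Regime2CombLargeN
import Literature.MathematicalPhysics.QuantumFieldTheory.Federbush1986.LocalStabilityHits
import Literature.MathematicalPhysics.QuantumFieldTheory.Federbush1986.PureAveragesUNLemma11
import Literature.MathematicalPhysics.QuantumFieldTheory.Federbush1986.PureAveragesUNLemma13Converse
import Literature.MathematicalPhysics.QuantumFieldTheory.Federbush1986.PureAveragesSUN
import Literature.MathematicalPhysics.QuantumFieldTheory.Federbush1986.PureAveragesSU2Lemma11
import Literature.MathematicalPhysics.QuantumFieldTheory.Federbush1986.PureAveragesSU2Lemma13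
import Literature.MathematicalPhysics.QuantumFieldTheory.Federbush1986.PureAveragesSU2Existence
import Literature.MathematicalPhysics.QuantumFieldTheory.Federbush1986.PureAveragesClosedSubgroup

/-!
# `Federbush1986.LocalStabilityThm42PrintedAlf` — [Federbush1987PhaseCellIII] §4 p. 298: print's redistributed large-field
# action `A_{l.f.}(P)` MODELLED on the lattice (p32 gen 7's `LocalStabilityHits`) and Local Stability Theorem 4.2 (4.4) p. 299
# for the tree's four-dimensional comb scheme WITH IT — the l.f. bookkeeping hypotheses of `Regime2CombLargeN` DISCHARGED,
# and Theorem 4.2 in print's quantifier order for every l.f. action dominating the inside shares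

statement-level skeleton of published theorems with citation tags; proofs where landed; nothing here is a claim about the Yang–Mills mass gap

CITATION HEADER.  P. Federbush, *A phase cell approach to Yang–Mills theory. III. Local stability, modified renormalization group
transformation*, Commun. Math. Phys. **110** (1987) 293–309 [Federbush1987PhaseCellIII].  Pages READ for this file (lit store
`paper:url-4700a514f365`, journal page = PDF page + 292; text layer `p0006.txt`/`p0007.txt` = pp. 298–299): p. 298 «A plaquette
p is s.f. if |A_{∂p}| < a (more properly, |g_{∂p}| < a, with definition at beginning of Sect. 5) and l.f. if |A_{∂p}| ≧ a. Each
vertex of a plaquette p at level s is contained in one N⁴ size block, a vertex in the level s − 1 lattice; it is said to hit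
this vertex. A plaquette p at level s is said to hit a bond or plaquette of the s − 1 lattice if it hits a vertex of this bond
or plaquette. … If one half the action, ½a², of a l.f. plaquette is distributed equally among all the plaquettes it hits,
A_{l.f.}(p) is the action associated to p by this process. We now specialize to two levels r and r + 1, and consider a single
plaquette P in the r level. We also consider exactly those plaquettes {p_i}_{i∈P} in the level r + 1 all of whose vertices lie
in the four N⁴ size blocks, vertices of the plaquette P. This is a smaller set of p_i than hit P. … Regime 2. Some of the p_i
are l.f., but A_{l.f.}(P) < 3a². Regime 3. A_{l.f.}(P) ≧ 3a². We note there is an absolute number r₁ such that if more than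
r₁ p_i are l.f., we are in Regime 3.»; p. 299 «Local Stability Theorem 4.2. There is a number f₁ > 0 such that in Regime 2,
Δ̃S(P) ≧ f₁a². (4.4)» … «All these results will hold for suitable fixed N, c_d, f₁, f₂, and a₀, where a must satisfy a < a₀.»

lit-balaban cell (HOME `run/shared/lean/pub/lit-balaban/`), unit `lit-balaban-r17` gen 15 (reader/typer r17 = fold owner of the
Federbush rows, row owner of F3.Thm4.2; free-target protocol G.5-34(d), TAKING line HOME/STATUS 2026-08-22T19:22:30Z, p32 gen 15
notified), SKELETON rows **F3.Thm4.2** and **F3.Def§4** («A_{l.f.}(p)», «hit», «r₁») of `HOME/lit-balaban-r17/SKELETON-r17.md`.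
Inputs BY NAME, none edited: p32's `Regime2CombLargeN` (**`LocalStabilityG.exists_cd_N₀_localStabilityTheorem42_of_lemmas`**,
p334043/p335604: Theorem 4.2 for `familyC 2 N hN r₁ c_d A_lf` for EVERY l.f. action `A_lf ≧ 0` obeying the HIT BOUND
`h·a² ≦ A_lf` and the COUNT BOUND `#lfSet ≦ r₁` in Regime 2 — the two bookkeeping hypotheses), p32 gen 7's `LocalStabilityHits`
(`Hits.Plaq`, `Hits.vertices`, `Hits.block`, `Hits.hitSet`, `Hits.card_hitSet_le`, **`Hits.Alf N a LF Q`** = «½a² of each l.f.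
plaquette distributed equally among all the plaquettes it hits», `Hits.le_Alf`, `Hits.InBlocks`, `Hits.mem_hitSet_of_inBlocks`,
`Hits.r₁`, **`Hits.regime3_of_card_lf_gt`**), `Regime2GScheme` (`lfSet`, `toHits`, `dir0`, `dir1`), `Regime2CombScheme` (`schemeC`,
`familyC`), `LocalStability` (`TwoLevelScheme`, `Regime2`, `deltaStilde`, `LocalStabilityTheorem42`); the model-instance §1
lemmas `UN.lemma11_UN`/`UN.lemma13_UN` (p12), `SU2.lemma11_SU2`/`SU2.lemma13_SU2`/`SU2.compactSpace` (p32),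
`UNLieSubgroup.lemma11H`/`lemma13H`/`ofClosed`, `SUNSubgroup` (r17 gen 8).  Parallel abstract form (p32 gen 15, `Regime2CombSU2`
v1.1, being re-filed at the time of writing): `exists_cd_N₀_localStabilityTheorem42_of_lfShare` keeps the hit number `m` ABSTRACT
and the share bound `#lfSet·a²/(2m) ≦ A_lf` as the HYPOTHESIS; here the hit combinatorics is the tree's `LocalStabilityHits` and
the share bound is a THEOREM (p32 gen 15 independently drafted the §2–§3 lattice lemmas as `Regime2CombAlfHits` and yielded them to
this file, HOME/lit-balaban-p32/INBOX.md 2026-08-22T19:59Z; free-target protocol G.5-34(d)).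

WHAT IS PROVED.
* §1 (the monotonicity print uses silently: «This is a smaller set of p_i than hit P»): for a two-level scheme `S`, the
  SUPPLEMENTED scheme `S.supplement X π A hle` — configurations `x : X` read through `π : X → S.Cfg` (same `|A_{∂P}|`,
  `|A_{∂p_j}|`, `α_j`, `f_s`) with an l.f. action `A x ≧ S.Alf (π x)` — satisfies: Regime 2 of `x` ⇒ Regime 2 of `π x`
  (`Regime2.of_supplement`), `Δ̃S(x) = Δ̃S(π x) + (A x − A_lf(π x)) ≧ Δ̃S(π x)` (`deltaStilde_supplement`), hence every
  Regime-2 bound `f₁a² ≦ Δ̃S` transfers with the SAME `f₁` (`regime2_bound_supplement`); Regime 1/3 and Theorem 4.3's bound likewise.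
* §2 (lattice): the coarse plaquette `P = (0; e₀, e₁)` as a `Hits.Plaq (d+2)` (`coarseP`); **every fine plaquette `p_j`
  (all four vertices in the four blocks) hits `P`** (`inBlocks_toHits`, `coarseP_mem_hitSet_toHits`); `toHits` is injective.
* §3 **`alfIn d N hN a U := Hits.Alf N a ((lfSet a U).image toHits) (coarseP d)`** — print's `A_{l.f.}(P)` computed from the l.f.
  plaquettes AMONG THE `p_i` (a function of the four-block configuration); the SHARE BOUND as a theorem
  (`card_lfSet_mul_share_le_alfIn`: `#lfSet·(a²/2)/(16(d+2)²) ≦ alfIn`), whence the HIT BOUND with `h = 1/(32(d+2)²)`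
  (`hit_bound_alfIn`) and the COUNT BOUND «if more than r₁ p_i are l.f., we are in Regime 3» with p32's `Hits.r₁ (d+2) = 96(d+2)²`
  (`card_lfSet_le_of_alfIn_lt`).
* §4 **Theorem 4.2 for the four-dimensional comb scheme with `A_lf := alfIn`, NO bookkeeping hypothesis**:
  `exists_cd_N₀_localStabilityTheorem42_alfIn_of_lemmas` (every compact `G` with §1 chart data; Lemmas 1.1, 1.3 as hypotheses)
  and the model instances `…_alfIn_UN` (every `N`), `…_alfIn_SU2`, `…_alfIn_H` (every `UNLieSubgroup`), `…_alfIn_SUN`,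
  `…_alfIn_closed` (ANY closed `H ≦ U(N)`) with NO hypothesis beyond `N ≧ N₀` («for suitable fixed N, c_d»).
* §5 **print's full `A_{l.f.}(P)`** also receives shares from l.f. plaquettes NOT among the `p_i` (they hit `P` through one
  vertex; their variables live outside the four-block carrier `Cfg G d N`) and print's hit counts are the sharp ones (p32's
  `hitSet` over-counts by degenerate direction pairs, so `Hits.Alf ≦` print's number for the same l.f. set): both only ADD a
  non-negative amount to `alfIn`.  `familySup X π A hle` = the comb family supplemented by ANY configuration space `X` over the
  four blocks and ANY l.f. action `A ≧ alfIn ∘ π`; **`localStabilityTheorem42_familySup`**: Theorem 4.2 transfers from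
  `familyC … alfIn` with the same `f₁, a₀` — i.e. `∃ f₁ a₀ ∀ a ∀ x` UNIFORMLY over the exterior data (print's quantifier order);
  `exists_cd_N₀_localStabilityTheorem42_sup_of_lemmas` + model instances; the literal instance (defined in §3) `alfFull a (U, LFext)
  := Hits.Alf N a ((lfSet a U).image toHits ∪ LFext) (coarseP d)` (the ambient configuration enters `A_{l.f.}(P)` only through the
  finite set `LFext` of its l.f. plaquettes outside the `p_i`; `hitsAlf_mono`, `alfIn_le_alfFull`), `familyFull`,
  `…_alfFull_of_lemmas` + model instances `…_alfFull_UN/_SU2/_H/_SUN/_closed`, `…_sup_UN/_SU2`.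

* §6–§7 (v1.1): **`exists_uniform_constants_sup_of_lemmas`** (+ `_UN/_SU2/_closed`) — the existential constants of Theorem 4.2
  pulled in front of the exterior data: `c_d`, `N ≧ N₀`, `f₁`, `a₀` fixed BEFORE `X`, `π`, `A`, `a`, `x` («for suitable fixed N, c_d,
  f₁, f₂, and a₀»); `regime3_schemeC_alfIn_of_card_lfSet_gt` («if more than r₁ p_i are l.f., we are in Regime 3» ON the comb
  scheme), `regime3_schemeSup_of_card_lfSet_gt`, `localStabilityTheorem43_familySup` (Theorem 4.3's statement transfers);
  §8 `card_lfSet_mul_share_le_alfIn'` = the share bound in p32 gen 15's `hshare` form (`m = 16(d+2)²`), so their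
  `exists_cd_N₀_localStabilityTheorem42_of_lfShare` applies verbatim to `A_lf := alfIn`.

HONEST SCOPE.  (a) Elementary bookkeeping and one-line specialisations; all the analysis is p32's comb chain.  (b) What stays
as in `Regime2CombLargeN`: print's dimension four (`d + 2 = 4` in §4–§5's Theorem-4.2 statements; §1–§3 are every dimension),
the tree's COMB rendering of Regime 2 in place of print's radial trees (HOME/GAPS.md G-F3-p32-08), and §1's Lemmas 1.1/1.3 as
hypotheses for an abstract compact `G` (theorems at the model instances).  (c) Constants are not print's: hit number bound
`16(d+2)²` (p32's count with degenerate direction pairs; in four dimensions each vertex lies in `4·C(4,2) = 24` plaquettes, so a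
fine plaquette hits at most `96`; print gives no number), `r₁ = 96(d+2)² = 1536` (print: «an absolute number r₁»),
`h = 1/(32(d+2)²)`.  (d) Row F3.Thm4.2 keeps its `typed` head (block rule G.1 / L-g2-1).  Definitions with bodies
(`TwoLevelScheme.supplement`, `coarseP`, `alfIn`, `hD`, `schemeSup`, `familySup`, `alfFull`, `familyFull`) + theorems; no new
named facts, no `sorry`; axioms standard.
-/

namespace Literature.MathematicalPhysics.QuantumFieldTheory.Federbush1986

noncomputable section

open scoped BigOperators

/-! ## §1 Monotonicity of the Regime-2 statement in `A_{l.f.}`: the supplemented two-level scheme -/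

namespace TwoLevelScheme

variable (S : TwoLevelScheme) (X : Type) (π : X → S.Cfg) (A : X → ℝ) (hle : ∀ x, S.Alf (π x) ≤ A x)

/-- **The supplemented scheme**: the same coarse plaquette `P`, block side, weights, sizes `|A_{∂P}|`, `|A_{∂p_j}|` and profile
`f_s`, on a configuration type `X` read through `π : X → S.Cfg`, with an l.f. action `A x ≧ A_{l.f.}(π x)` — the extra shares
`P` receives from l.f. plaquettes that are not among the `p_i` («This is a smaller set of p_i than hit P»).
[cite: Federbush1987PhaseCellIII, §4 p. 298] -/
def supplement : TwoLevelScheme where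
  N := S.N
  a := S.a
  a_pos := S.a_pos
  J := S.J
  α := S.α
  α_nonneg := S.α_nonneg
  sum_α := S.sum_α
  Cfg := X
  coarse := fun x => S.coarse (π x)
  coarse_nonneg := fun x => S.coarse_nonneg (π x)
  fine := fun x => S.fine (π x)
  fine_nonneg := fun x j => S.fine_nonneg (π x) j
  Alf := A
  Alf_nonneg := fun x => (S.Alf_nonneg (π x)).trans (hle x)
  fs := S.fs

variable {S X π A hle}

/-- The threshold is unchanged. [cite: Federbush1987PhaseCellIII, §4 p. 298] -/
@[simp] theorem supplement_a : (S.supplement X π A hle).a = S.a := rfl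

/-- The l.f. action of the supplemented scheme is `A`. [cite: Federbush1987PhaseCellIII, §4 p. 298] -/
@[simp] theorem supplement_Alf (x : X) : (S.supplement X π A hle).Alf x = A x := rfl

/-- The fine sizes are read through `π`. [cite: Federbush1987PhaseCellIII, §4 p. 298] -/
@[simp] theorem supplement_fine (x : X) (j : S.J) : (S.supplement X π A hle).fine x j = S.fine (π x) j := rfl

/-- s.f. is read through `π`. [cite: Federbush1987PhaseCellIII, §4 p. 298] -/
theorem supplement_sf_iff (x : X) (j : S.J) : (S.supplement X π A hle).sf x j ↔ S.sf (π x) j := Iff.rfl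

/-- l.f. is read through `π`. [cite: Federbush1987PhaseCellIII, §4 p. 298] -/
theorem supplement_lf_iff (x : X) (j : S.J) : (S.supplement X π A hle).lf x j ↔ S.lf (π x) j := Iff.rfl

/-- Regime 1 is read through `π`. [cite: Federbush1987PhaseCellIII, §4 p. 298 «Regime 1»] -/
theorem supplement_regime1_iff (x : X) : (S.supplement X π A hle).Regime1 x ↔ S.Regime1 (π x) := Iff.rfl

/-- **Regime 2 of the supplemented scheme implies Regime 2 underneath** («Some of the p_i are l.f., but A_{l.f.}(P) < 3a²»:
the same l.f. `p_i`, and `A_{l.f.}(π x) ≦ A x < 3a²`). [cite: Federbush1987PhaseCellIII, §4 p. 298 «Regime 2»] -/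
theorem Regime2.of_supplement {x : X} (h : (S.supplement X π A hle).Regime2 x) : S.Regime2 (π x) :=
  ⟨h.1, (hle x).trans_lt h.2⟩

/-- Regime 3 underneath implies Regime 3 of the supplemented scheme. [cite: Federbush1987PhaseCellIII, §4 p. 298 «Regime 3»] -/
theorem Regime3.supplement {x : X} (h : S.Regime3 (π x)) : (S.supplement X π A hle).Regime3 x :=
  le_trans h (hle x)

/-- **`Δ̃S` of the supplemented scheme = `Δ̃S` underneath + the extra shares** ((4.2): `A_{l.f.}(P)` enters `Δ̃S(P)` additively,
the s.f. sum and `S_M(P)` are read through `π`). [cite: Federbush1987PhaseCellIII, (4.2) p. 298] -/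
theorem deltaStilde_supplement (x : X) :
    (S.supplement X π A hle).deltaStilde x = S.deltaStilde (π x) + (A x - S.Alf (π x)) := by
  have h1 : (S.supplement X π A hle).deltaStilde x = A x + (S.N : ℝ) ^ 2 *
      ∑ j ∈ Finset.univ.filter (fun j => S.sf (π x) j), S.α j * S.SMfine (π x) j - S.SMcoarse (π x) := rfl
  have h2 : S.deltaStilde (π x) = S.Alf (π x) + (S.N : ℝ) ^ 2 *
      ∑ j ∈ Finset.univ.filter (fun j => S.sf (π x) j), S.α j * S.SMfine (π x) j - S.SMcoarse (π x) := rfl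
  rw [h1, h2]
  ring

/-- Hence `Δ̃S(π x) ≦ Δ̃S(x)`. [cite: Federbush1987PhaseCellIII, (4.2) p. 298] -/
theorem deltaStilde_le_supplement (x : X) : S.deltaStilde (π x) ≤ (S.supplement X π A hle).deltaStilde x := by
  rw [deltaStilde_supplement]
  linarith [hle x]

/-- **Every Regime-2 lower bound transfers to the supplemented scheme with the same constant.**
[cite: Federbush1987PhaseCellIII, Local Stability Theorem 4.2 (4.4) p. 299; §4 p. 298] -/
theorem regime2_bound_supplement {c : ℝ} (H : ∀ u, S.Regime2 u → c ≤ S.deltaStilde u) :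
    ∀ x, (S.supplement X π A hle).Regime2 x → c ≤ (S.supplement X π A hle).deltaStilde x :=
  fun x hx => (H (π x) (Regime2.of_supplement hx)).trans (deltaStilde_le_supplement x)

/-- Every Regime-1 lower bound transfers likewise (Theorem 4.3's shape: the bound depends on the fine sizes only).
[cite: Federbush1987PhaseCellIII, Local Stability Theorem 4.3 (4.5) p. 299] -/
theorem regime1_bound_supplement {B : (S.J → ℝ) → ℝ} (H : ∀ u, S.Regime1 u → B (S.fine u) ≤ S.deltaStilde u) :
    ∀ x, (S.supplement X π A hle).Regime1 x → B ((S.supplement X π A hle).fine x) ≤ (S.supplement X π A hle).deltaStilde x :=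
  fun x hx => (H (π x) ((supplement_regime1_iff x).1 hx)).trans (deltaStilde_le_supplement x)

end TwoLevelScheme

/-! ## §2 The coarse plaquette `P` and the fine plaquettes `p_j` as lattice plaquettes: every `p_j` hits `P` -/

namespace LocalStabilityG

open LocalStabilitySU2D (side side_le InBox intSite pt_intSite)

section Lattice

variable (d N : ℕ)

/-- The coarse plaquette `P = (0; e₀, e₁)` of the level-`r` lattice as a lattice plaquette (corner `0`, directions `e₀, e₁`), in
COARSE coordinates (its vertices `0, e₀, e₁, e₀ + e₁` are the four blocks). [cite: Federbush1987PhaseCellIII, §4 p. 298] -/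
def coarseP : Hits.Plaq (d + 2) := (0, dir0 d, dir1 d)

/-- A coarse site with coordinates `∈ {0,1}` along `e₀, e₁` and `0` elsewhere is a vertex of `P`.
[cite: Federbush1987PhaseCellIII, §4 p. 298] -/
theorem mem_vertices_coarseP {v : Fin (d + 2) → ℤ} (h0 : v (dir0 d) = 0 ∨ v (dir0 d) = 1)
    (h1 : v (dir1 d) = 0 ∨ v (dir1 d) = 1) (hrest : ∀ k, k ≠ dir0 d → k ≠ dir1 d → v k = 0) :
    v ∈ Hits.vertices (coarseP d) := by
  have hne := dir0_ne_dir1 d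
  have hv : v = v (dir0 d) • Pi.single (dir0 d) (1 : ℤ) + v (dir1 d) • Pi.single (dir1 d) (1 : ℤ) := by
    funext k
    by_cases hk0 : k = dir0 d
    · subst hk0; simp [hne]
    · by_cases hk1 : k = dir1 d
      · subst hk1; simp [hk0]
      · simp [hrest k hk0 hk1, hk0, hk1]
  simp only [Hits.vertices, coarseP, Finset.mem_insert, Finset.mem_singleton, zero_add]
  rcases h0 with h0 | h0 <;> rcases h1 with h1 | h1
  · left; rw [hv, h0, h1]; simp
  · right; right; left; rw [hv, h0, h1]; simp
  · right; left; rw [hv, h0, h1]; simp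
  · right; right; right; rw [hv, h0, h1]; simp

variable {d N}

/-- The block of a fine site of the four blocks (`{0,…,2N−1}² × {0,…,N−1}^d`) is a vertex of `P`.
[cite: Federbush1987PhaseCellIII, §4 p. 298 «Each vertex of a plaquette p at level s is contained in one N⁴ size block»] -/
theorem block_mem_vertices_coarseP (hN : 0 < N) {c : Fin (d + 2) → ℤ} (hc : ∀ k, 0 ≤ c k ∧ c k < side d N k) :
    Hits.block N c ∈ Hits.vertices (coarseP d) := by
  have hNz : (0 : ℤ) < N := by exact_mod_cast hN
  have h01 : ∀ k, c k / (N : ℤ) = 0 ∨ c k / (N : ℤ) = 1 := by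
    intro k
    have h0 : 0 ≤ c k / (N : ℤ) := Int.ediv_nonneg (hc k).1 hNz.le
    have h2 : c k / (N : ℤ) < 2 := by
      rw [Int.ediv_lt_iff_lt_mul hNz]
      have := (hc k).2; have := side_le d N k; omega
    omega
  have hzero : ∀ k : Fin (d + 2), 2 ≤ k.val → c k / (N : ℤ) = 0 := by
    intro k hk
    have hs : side d N k = N := by
      have : ¬ k.val < 2 := Nat.not_lt.2 hk
      simp [side, this]
    have h0 : 0 ≤ c k / (N : ℤ) := Int.ediv_nonneg (hc k).1 hNz.le
    have h1 : c k / (N : ℤ) < 1 := by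
      rw [Int.ediv_lt_iff_lt_mul hNz]
      have := (hc k).2; rw [hs] at this; omega
    omega
  refine mem_vertices_coarseP d (h01 _) (h01 _) fun k hk0 hk1 => hzero k ?_
  by_contra hlt
  have h2 : k.val = 0 ∨ k.val = 1 := by omega
  rcases h2 with h | h
  · exact hk0 (Fin.ext (by simpa [dir0] using h))
  · exact hk1 (Fin.ext (by simpa [dir1] using h))

/-- The four vertices of a fine plaquette `p_j` (as a lattice plaquette `toHits j`) lie in the four blocks.
[cite: Federbush1987PhaseCellIII, §4 p. 298 «all of whose vertices lie in the four N⁴ size blocks»] -/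
theorem vertices_toHits_bound (j : LocalStabilitySU2D.Plaq d N) :
    ∀ c ∈ Hits.vertices (toHits d N j), ∀ k, 0 ≤ c k ∧ c k < side d N k := by
  obtain ⟨⟨x, κ, μ⟩, hκμ, hbox, hκ, hμ⟩ := j
  intro c hc k
  have hxk : (x k : ℕ) < side d N k := hbox k
  simp only [toHits, Hits.vertices, Finset.mem_insert, Finset.mem_singleton] at hc
  simp only at hκ hμ hκμ
  rcases hc with rfl | rfl | rfl | rfl
  · simp only [LocalStabilitySU2D.intSite_apply]; omega
  · by_cases h : k = κ
    · subst h; simp; omega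
    · simp [h]; omega
  · by_cases h : k = μ
    · subst h; simp; omega
    · simp [h]; omega
  · by_cases h : k = κ
    · by_cases h' : k = μ
      · exact absurd hκμ (by rw [← h, ← h']; exact lt_irrefl _)
      · subst h; simp [h']; omega
    · by_cases h' : k = μ
      · subst h'; simp [h]; omega
      · simp [h, h']; omega

/-- **Every `p_j` lies in the four blocks of `P`** (`Hits.InBlocks`), hence **hits `P`** («This is a smaller set of p_i than hit P»).
[cite: Federbush1987PhaseCellIII, §4 p. 298] -/
theorem inBlocks_toHits (hN : 0 < N) (j : LocalStabilitySU2D.Plaq d N) : Hits.InBlocks N (coarseP d) (toHits d N j) :=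
  fun c hc => block_mem_vertices_coarseP hN (vertices_toHits_bound j c hc)

/-- `P` is among the plaquettes hit by `p_j`. [cite: Federbush1987PhaseCellIII, §4 p. 298] -/
theorem coarseP_mem_hitSet_toHits (hN : 0 < N) (j : LocalStabilitySU2D.Plaq d N) :
    coarseP d ∈ Hits.hitSet N (toHits d N j) :=
  Hits.mem_hitSet_of_inBlocks (inBlocks_toHits hN j)

/-- Distinct `p_j` are distinct lattice plaquettes. [cite: Federbush1987PhaseCellIII, §4 p. 298] -/
theorem toHits_injective (hN : 0 < N) : Function.Injective (toHits d N) := by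
  intro j₁ j₂ h
  simp only [toHits, Prod.mk.injEq] at h
  obtain ⟨h1, h2, h3⟩ := h
  have h1' : j₁.1.1 = j₂.1.1 := by rw [← pt_intSite d N hN j₁.1.1, ← pt_intSite d N hN j₂.1.1, h1]
  exact Subtype.ext (Prod.ext h1' (Prod.ext h2 h3))

end Lattice

/-! ## §3 Print's `A_{l.f.}(P)` from the l.f. plaquettes among the `p_i`; the share, hit and count bounds as theorems -/

section Alf

variable {G : Type} [Group G] [MetricSpace G] (d N : ℕ) (hN : 0 < N)

/-- The hit constant `h = (½)/(16(d+2)²) = 1/(32(d+2)²)`: the least share of `½a²` a plaquette receives from one l.f. plaquette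
hitting it, with p32's bound `#hitSet ≦ 16(d+2)²` on the number of plaquettes hit. [cite: Federbush1987PhaseCellIII, §4 p. 298] -/
def hD (d : ℕ) : ℝ := 1 / (32 * ((d : ℝ) + 2) ^ 2)

/-- `h > 0`. [cite: Federbush1987PhaseCellIII, §4 p. 298] -/
theorem hD_pos (d : ℕ) : 0 < hD d := by unfold hD; positivity

/-- **`A_{l.f.}(P)` from the `p_i`**: «one half the action, ½a², of a l.f. plaquette … distributed equally among all the
plaquettes it hits», summed over the l.f. plaquettes among the `p_i` (the `p_j` with `|g_{∂p_j}| ≧ a`, `lfSet`), i.e. p32's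
`Hits.Alf` of the lattice set `lfSet.image toHits` at the coarse plaquette `P` — a function of the four-block configuration.
The shares `P` receives from l.f. plaquettes NOT among the `p_i` are added in §5. [cite: Federbush1987PhaseCellIII, §4 p. 298] -/
def alfIn (a : ℝ) (U : Cfg G d N) : ℝ := Hits.Alf N a ((lfSet d N hN a U).image (toHits d N)) (coarseP d)

/-- `A_{l.f.}(P) ≧ 0`. [cite: Federbush1987PhaseCellIII, §4 p. 298] -/
theorem alfIn_nonneg (a : ℝ) (U : Cfg G d N) : 0 ≤ alfIn d N hN a U := Hits.Alf_nonneg _ _ _ _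

/-- All the l.f. `p_i` hit `P`: the hitting filter of `Hits.Alf` is everything. [cite: Federbush1987PhaseCellIII, §4 p. 298] -/
theorem filter_hits_image_lfSet (a : ℝ) (U : Cfg G d N) :
    ((lfSet d N hN a U).image (toHits d N)).filter (fun p => coarseP d ∈ Hits.hitSet N p) =
      (lfSet d N hN a U).image (toHits d N) :=
  Finset.filter_true_of_mem fun p hp => by
    obtain ⟨j, _, rfl⟩ := Finset.mem_image.1 hp
    exact coarseP_mem_hitSet_toHits hN j

/-- The l.f. `p_i` as lattice plaquettes are as many as the l.f. `p_i`. [cite: Federbush1987PhaseCellIII, §4 p. 298] -/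
theorem card_image_lfSet (a : ℝ) (U : Cfg G d N) :
    ((lfSet d N hN a U).image (toHits d N)).card = (lfSet d N hN a U).card :=
  Finset.card_image_of_injective _ (toHits_injective hN)

/-- **The share bound** (p32 gen 15's hypothesis `hshare`, here a theorem): each l.f. `p_i` hits `P` and at most `16(d+2)²`
plaquettes, so `A_{l.f.}(P) ≧ #{l.f. p_i}·(½a²)/(16(d+2)²)`. [cite: Federbush1987PhaseCellIII, §4 p. 298] -/
theorem card_lfSet_mul_share_le_alfIn (a : ℝ) (U : Cfg G d N) :
    ((lfSet d N hN a U).card : ℝ) * ((a ^ 2 / 2) / (16 * ((d + 2 : ℕ) : ℝ) ^ 2)) ≤ alfIn d N hN a U := by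
  have h := Hits.le_Alf N a ((lfSet d N hN a U).image (toHits d N)) (coarseP d) (by omega : 1 ≤ d + 2)
  rw [filter_hits_image_lfSet, card_image_lfSet] at h
  exact h

/-- **The hit bound** (the first bookkeeping hypothesis of `Regime2CombLargeN`, here a theorem): «Some of the p_i are l.f.» forces
`A_{l.f.}(P) ≧ h·a²` with `h = 1/(32(d+2)²)` (the Regime-2 clause `A_{l.f.}(P) < 3a²` is not used).
[cite: Federbush1987PhaseCellIII, §4 p. 298] -/
theorem hit_bound_alfIn : ∀ a : ℝ, 0 < a → ∀ U : Cfg G d N, (∃ j, a ≤ dist 1 (plaqHol d N hN U j)) →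
    alfIn d N hN a U < 3 * a ^ 2 → hD d * a ^ 2 ≤ alfIn d N hN a U := by
  intro a _ U hj _
  obtain ⟨j, hj⟩ := hj
  have hmem : j ∈ lfSet d N hN a U := Finset.mem_filter.2 ⟨Finset.mem_univ _, hj⟩
  have hcard : (1 : ℝ) ≤ (lfSet d N hN a U).card := by exact_mod_cast Finset.card_pos.2 ⟨j, hmem⟩
  have hq : 0 ≤ (a ^ 2 / 2) / (16 * ((d + 2 : ℕ) : ℝ) ^ 2) := by positivity
  calc hD d * a ^ 2 = 1 * ((a ^ 2 / 2) / (16 * ((d + 2 : ℕ) : ℝ) ^ 2)) := by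
        rw [hD]; push_cast; field_simp; ring
    _ ≤ ((lfSet d N hN a U).card : ℝ) * ((a ^ 2 / 2) / (16 * ((d + 2 : ℕ) : ℝ) ^ 2)) :=
        mul_le_mul_of_nonneg_right hcard hq
    _ ≤ alfIn d N hN a U := card_lfSet_mul_share_le_alfIn d N hN a U

/-- **The count bound** «We note there is an absolute number r₁ such that if more than r₁ p_i are l.f., we are in Regime 3» (the
second bookkeeping hypothesis of `Regime2CombLargeN`, here a theorem with p32's `r₁ = 96(d+2)²`): `A_{l.f.}(P) < 3a²` allows at
most `r₁` l.f. `p_i`. [cite: Federbush1987PhaseCellIII, §4 p. 298] -/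
theorem card_lfSet_le_of_alfIn_lt : ∀ a : ℝ, 0 < a → ∀ U : Cfg G d N, alfIn d N hN a U < 3 * a ^ 2 →
    (lfSet d N hN a U).card ≤ Hits.r₁ (d + 2) := by
  intro a _ U hlt
  classical
  by_contra hgt
  have hall : ((lfSet d N hN a U).image (toHits d N)).filter (Hits.InBlocks N (coarseP d)) =
      (lfSet d N hN a U).image (toHits d N) :=
    Finset.filter_true_of_mem fun p hp => by
      obtain ⟨j, _, rfl⟩ := Finset.mem_image.1 hp
      exact inBlocks_toHits hN j
  have hgt' : Hits.r₁ (d + 2) < (((lfSet d N hN a U).image (toHits d N)).filter (Hits.InBlocks N (coarseP d))).card := by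
    rw [hall, card_image_lfSet]; exact Nat.lt_of_not_le hgt
  have h3 := Hits.regime3_of_card_lf_gt N a _ _ hgt'
  exact absurd hlt (not_lt.2 h3)

/-- **`Hits.Alf` is monotone in the set of l.f. plaquettes** (every share is `≧ 0`). [cite: Federbush1987PhaseCellIII, §4 p. 298] -/
theorem hitsAlf_mono {D : ℕ} (N : ℕ) (a : ℝ) {LF LF' : Finset (Hits.Plaq D)} (h : LF ⊆ LF') (Q : Hits.Plaq D) :
    Hits.Alf N a LF Q ≤ Hits.Alf N a LF' Q :=
  Finset.sum_le_sum_of_subset_of_nonneg (Finset.filter_subset_filter _ h) fun _ _ _ => by positivity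

/-- **Print's full `A_{l.f.}(P)`** on the configuration type `Cfg G d N × Finset (Hits.Plaq (d+2))`: the four-block configuration
`U` together with the finite set `LFext` of l.f. level-`(r+1)` plaquettes of the ambient configuration that are NOT among the
`p_i` (the ambient configuration enters `A_{l.f.}(P)` only through this set): «½a² of each l.f. plaquette distributed equally
among all the plaquettes it hits», summed over `lfSet.image toHits ∪ LFext`. [cite: Federbush1987PhaseCellIII, §4 p. 298] -/
def alfFull (a : ℝ) (x : Cfg G d N × Finset (Hits.Plaq (d + 2))) : ℝ :=
  Hits.Alf N a ((lfSet d N hN a x.1).image (toHits d N) ∪ x.2) (coarseP d)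

/-- The exterior l.f. plaquettes only add: `alfIn U ≦ alfFull (U, LFext)`. [cite: Federbush1987PhaseCellIII, §4 p. 298] -/
theorem alfIn_le_alfFull (a : ℝ) (x : Cfg G d N × Finset (Hits.Plaq (d + 2))) :
    alfIn d N hN a x.1 ≤ alfFull d N hN a x :=
  hitsAlf_mono N a Finset.subset_union_left _

end Alf

/-! ## §4 Theorem 4.2 for the four-dimensional comb scheme with `A_{l.f.} := alfIn` — no bookkeeping hypothesis -/

section Thm42

variable {G : Type} [Group G] [MetricSpace G] [CompactSpace G] [IsIsometricSMul G G] [IsIsometricSMul Gᵐᵒᵖ G]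
variable {𝔤 : Type*} [NormedAddCommGroup 𝔤] [InnerProductSpace ℝ 𝔤] (L : LocalLog G 𝔤)

/-- **Theorem 4.2 for the four-dimensional comb scheme with print's `A_{l.f.}(P)` from the `p_i`, from the chart's Lemma 1.1 and
Lemma 1.3 alone** — the hit bound and the count bound of `Regime2CombLargeN.exists_cd_N₀_localStabilityTheorem42_of_lemmas`
DISCHARGED (`hit_bound_alfIn`, `card_lfSet_le_of_alfIn_lt`; `h = 1/512`, `r₁ = 1536`): there are `c_d > 0` and `N₀` such that
for every block side `N ≧ N₀` the family `familyC 2 N hN r₁ c_d alfIn` satisfies «∃ f₁ > 0, ∃ a₀ > 0, ∀ a < a₀: in Regime 2,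
Δ̃S(P) ≧ f₁a²». [cite: Federbush1987PhaseCellIII, Local Stability Theorem 4.2 (4.4) p. 299 «for suitable fixed N, c_d»; §4
p. 298; Lemmas 1.1, 1.3 p. 295; §5.3 10) p. 305] -/
theorem exists_cd_N₀_localStabilityTheorem42_alfIn_of_lemmas (h11 : Lemma11 L.exp) (h13 : Lemma13 L.exp) :
    ∃ cd : ℝ, 0 < cd ∧ ∃ N₀ : ℕ, ∀ (N : ℕ) (hN : 0 < N), N₀ ≤ N →
      TwoLevelScheme.LocalStabilityTheorem42
        (familyC 2 N hN (Hits.r₁ (2 + 2)) cd (alfIn (G := G) 2 N hN) (alfIn_nonneg 2 N hN)) := by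
  obtain ⟨cd, hcd, N₀, H⟩ := exists_cd_N₀_localStabilityTheorem42_of_lemmas L h11 h13 (Hits.r₁ (2 + 2)) (hD_pos 2)
  exact ⟨cd, hcd, N₀, fun N hN hN₀ => H N hN hN₀ (alfIn 2 N hN) (alfIn_nonneg 2 N hN) (hit_bound_alfIn 2 N hN)
    (card_lfSet_le_of_alfIn_lt 2 N hN)⟩

end Thm42

section Thm42Instances

/-- **Model instance `G = U(N)`, every `N`: Theorem 4.2 for the comb scheme with print's `A_{l.f.}(P)` from the `p_i`, NO
hypothesis** (Lemma 1.1 = `UN.lemma11_UN`, Lemma 1.3 = `UN.lemma13_UN` at `UN.localLog`).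
[cite: Federbush1987PhaseCellIII, Local Stability Theorem 4.2 (4.4) p. 299; §4 p. 298; §5.3 10) p. 305] -/
theorem exists_cd_N₀_localStabilityTheorem42_alfIn_UN {n : ℕ} :
    ∃ cd : ℝ, 0 < cd ∧ ∃ N₀ : ℕ, ∀ (N : ℕ) (hN : 0 < N), N₀ ≤ N →
      TwoLevelScheme.LocalStabilityTheorem42
        (familyC 2 N hN (Hits.r₁ (2 + 2)) cd (alfIn (G := UN n) 2 N hN) (alfIn_nonneg 2 N hN)) :=
  exists_cd_N₀_localStabilityTheorem42_alfIn_of_lemmas UN.localLog UN.lemma11_UN UN.lemma13_UN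

attribute [local instance] SU2.compactSpace in
/-- **Model instance `G = SU(2)`** (unit quaternions, great-circle distance; p. 294 «We let G be a compact Lie Group and d(·,·)
an invariant distance constructed from an invariant metric on G»): Theorem 4.2 for the comb scheme with print's `A_{l.f.}(P)` from
the `p_i`, NO hypothesis (Lemma 1.1 = `SU2.lemma11_SU2`,
Lemma 1.3 = `SU2.lemma13_SU2` at `SU2.localLog`, compactness `SU2.compactSpace`).
[cite: Federbush1987PhaseCellIII, Local Stability Theorem 4.2 (4.4) p. 299; §1 p. 294; §4 p. 298] -/
theorem exists_cd_N₀_localStabilityTheorem42_alfIn_SU2 :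
    ∃ cd : ℝ, 0 < cd ∧ ∃ N₀ : ℕ, ∀ (N : ℕ) (hN : 0 < N), N₀ ≤ N →
      TwoLevelScheme.LocalStabilityTheorem42
        (familyC 2 N hN (Hits.r₁ (2 + 2)) cd (alfIn (G := SU2) 2 N hN) (alfIn_nonneg 2 N hN)) :=
  exists_cd_N₀_localStabilityTheorem42_alfIn_of_lemmas SU2.localLog SU2.lemma11_SU2 SU2.lemma13_SU2

/-- **Model instance `G = H`, every closed locally exponential `H ≦ U(N)`** (`UNLieSubgroup` datum `D`): Theorem 4.2 for the
comb scheme with print's `A_{l.f.}(P)` from the `p_i`, NO hypothesis (Lemma 1.1 = `D.lemma11H`, Lemma 1.3 = `D.lemma13H`).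
[cite: Federbush1987PhaseCellIII, Local Stability Theorem 4.2 (4.4) p. 299; p. 294 «G a compact Lie Group»; §4 p. 298] -/
theorem exists_cd_N₀_localStabilityTheorem42_alfIn_H {n : ℕ} (D : UNLieSubgroup n) :
    ∃ cd : ℝ, 0 < cd ∧ ∃ N₀ : ℕ, ∀ (N : ℕ) (hN : 0 < N), N₀ ≤ N →
      TwoLevelScheme.LocalStabilityTheorem42
        (familyC 2 N hN (Hits.r₁ (2 + 2)) cd (alfIn (G := D.H) 2 N hN) (alfIn_nonneg 2 N hN)) :=
  exists_cd_N₀_localStabilityTheorem42_alfIn_of_lemmas D.localLog D.lemma11H D.lemma13H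

/-- **Model instance `G = SU(N)`, every `N`** (p32's carrier `SUN n`, via the datum `SUNSubgroup n`): Theorem 4.2 for the comb
scheme with print's `A_{l.f.}(P)` from the `p_i`, NO hypothesis. [cite: Federbush1987PhaseCellIII, Local Stability Theorem 4.2
(4.4) p. 299; §4 p. 298; Federbush1987PhaseCellVI, p. 17–19 «compact simple Lie group»] -/
theorem exists_cd_N₀_localStabilityTheorem42_alfIn_SUN {n : ℕ} :
    ∃ cd : ℝ, 0 < cd ∧ ∃ N₀ : ℕ, ∀ (N : ℕ) (hN : 0 < N), N₀ ≤ N →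
      TwoLevelScheme.LocalStabilityTheorem42
        (familyC 2 N hN (Hits.r₁ (2 + 2)) cd (alfIn (G := SUN n) 2 N hN) (alfIn_nonneg 2 N hN)) :=
  exists_cd_N₀_localStabilityTheorem42_alfIn_H (SUNSubgroup n)

/-- **Model instance `G = H`, `H` ANY closed subgroup of `U(N)`** (chart `UNLieSubgroup.ofClosed`, Cartan–von Neumann): Theorem
4.2 for the comb scheme with print's `A_{l.f.}(P)` from the `p_i`, NO hypothesis. [cite: Federbush1987PhaseCellIII, Local
Stability Theorem 4.2 (4.4) p. 299; p. 294 «G a compact Lie Group»; §4 p. 298] -/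
theorem exists_cd_N₀_localStabilityTheorem42_alfIn_closed {n : ℕ} (H : Subgroup (UN n)) (hH : IsClosed (H : Set (UN n))) :
    ∃ cd : ℝ, 0 < cd ∧ ∃ N₀ : ℕ, ∀ (N : ℕ) (hN : 0 < N), N₀ ≤ N →
      TwoLevelScheme.LocalStabilityTheorem42
        (familyC 2 N hN (Hits.r₁ (2 + 2)) cd (alfIn (G := (UNLieSubgroup.ofClosed H hH).H) 2 N hN)
          (alfIn_nonneg 2 N hN)) :=
  exists_cd_N₀_localStabilityTheorem42_alfIn_H (UNLieSubgroup.ofClosed H hH)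

end Thm42Instances

/-! ## §5 The full `A_{l.f.}(P)`: shares from l.f. plaquettes not among the `p_i` — Theorem 4.2 in print's quantifier order -/

section Sup

variable {G : Type} [Group G] [MetricSpace G] [CompactSpace G] (d N : ℕ) (hN : 0 < N) (r₁ : ℕ)

/-- The comb scheme at threshold `a` with `A_{l.f.} := alfIn`, SUPPLEMENTED (§1): configurations `x : X` whose four-block part is
`π x`, with an l.f. action `A x ≧ alfIn (π x)` — `P` also receives shares from l.f. plaquettes hitting it through one vertex
only («This is a smaller set of p_i than hit P»), and print's hit counts are sharper than p32's `hitSet`; both only add to `alfIn`.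
[cite: Federbush1987PhaseCellIII, §4 p. 298] -/
def schemeSup (cd a : ℝ) (ha : 0 < a) (X : Type) (π : X → Cfg G d N) (A : X → ℝ)
    (hle : ∀ x, alfIn d N hN a (π x) ≤ A x) : TwoLevelScheme :=
  (schemeC d N hN r₁ cd a ha (alfIn d N hN a) (alfIn_nonneg d N hN a)).supplement X π A hle

/-- The `a`-family of the supplemented comb schemes. [cite: Federbush1987PhaseCellIII, §4 p. 299] -/
def familySup (cd : ℝ) (X : Type) (π : X → Cfg G d N) (A : ℝ → X → ℝ)
    (hle : ∀ a x, alfIn d N hN a (π x) ≤ A a x) : ℝ → TwoLevelScheme := fun a =>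
  if h : 0 < a then schemeSup d N hN r₁ cd a h X π (A a) (hle a)
  else schemeSup d N hN r₁ cd 1 one_pos X π (A 1) (hle 1)

/-- The family at a positive threshold. [cite: Federbush1987PhaseCellIII, §4 p. 299] -/
theorem familySup_of_pos (cd : ℝ) (X : Type) (π : X → Cfg G d N) (A : ℝ → X → ℝ)
    (hle : ∀ a x, alfIn d N hN a (π x) ≤ A a x) {a : ℝ} (ha : 0 < a) :
    familySup d N hN r₁ cd X π A hle a = schemeSup d N hN r₁ cd a ha X π (A a) (hle a) := by
  simp [familySup, ha]

/-- **Theorem 4.2 transfers from `A_{l.f.} := alfIn` to every supplemented family WITH THE SAME `f₁, a₀`** — print's quantifier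
order «There is a number f₁ > 0 such that in Regime 2, Δ̃S(P) ≧ f₁a²», uniformly over the exterior l.f. data carried by `X`.
[cite: Federbush1987PhaseCellIII, Local Stability Theorem 4.2 (4.4) p. 299; §4 p. 298] -/
theorem localStabilityTheorem42_familySup (cd : ℝ) (X : Type) (π : X → Cfg G d N) (A : ℝ → X → ℝ)
    (hle : ∀ a x, alfIn d N hN a (π x) ≤ A a x)
    (H : TwoLevelScheme.LocalStabilityTheorem42 (familyC d N hN r₁ cd (alfIn (G := G) d N hN) (alfIn_nonneg d N hN))) :
    TwoLevelScheme.LocalStabilityTheorem42 (familySup d N hN r₁ cd X π A hle) := by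
  obtain ⟨f₁, hf₁, a₀, ha₀, H⟩ := H
  refine ⟨f₁, hf₁, a₀, ha₀, fun a ha ha₀ => ?_⟩
  obtain ⟨_, Ha⟩ := H a ha ha₀
  rw [familyC_of_pos d N hN r₁ cd _ _ ha] at Ha
  rw [familySup_of_pos d N hN r₁ cd X π A hle ha]
  exact ⟨rfl, TwoLevelScheme.regime2_bound_supplement Ha⟩

/-- The `a`-family of comb schemes with print's full `A_{l.f.}(P)` (configurations = four-block configuration × exterior l.f. set).
[cite: Federbush1987PhaseCellIII, §4 p. 298–299] -/
def familyFull (cd : ℝ) : ℝ → TwoLevelScheme :=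
  familySup d N hN r₁ cd (Cfg G d N × Finset (Hits.Plaq (d + 2))) Prod.fst (alfFull d N hN) (alfIn_le_alfFull d N hN)

variable [IsIsometricSMul G G] [IsIsometricSMul Gᵐᵒᵖ G]
variable {𝔤 : Type*} [NormedAddCommGroup 𝔤] [InnerProductSpace ℝ 𝔤] (L : LocalLog G 𝔤)

/-- **Theorem 4.2 for the four-dimensional comb scheme supplemented by ANY exterior l.f. data, in print's quantifier order** (every
compact `G` with §1 chart data; Lemmas 1.1, 1.3 as hypotheses): there are `c_d > 0` and `N₀` such that for all `N ≧ N₀`, every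
configuration space `X` over the four blocks and every l.f. action `A ≧ alfIn ∘ π` on it, the family `familySup 2 N hN r₁ c_d X π A`
satisfies «∃ f₁ > 0, ∃ a₀ > 0, ∀ a < a₀, ∀ x ∈ Regime 2: Δ̃S ≧ f₁a²». [cite: Federbush1987PhaseCellIII, Local Stability Theorem 4.2
(4.4) p. 299; §4 p. 298; §5.3 10) p. 305] -/
theorem exists_cd_N₀_localStabilityTheorem42_sup_of_lemmas (h11 : Lemma11 L.exp) (h13 : Lemma13 L.exp) :
    ∃ cd : ℝ, 0 < cd ∧ ∃ N₀ : ℕ, ∀ (N : ℕ) (hN : 0 < N), N₀ ≤ N →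
      ∀ (X : Type) (π : X → Cfg G 2 N) (A : ℝ → X → ℝ) (hle : ∀ a x, alfIn 2 N hN a (π x) ≤ A a x),
        TwoLevelScheme.LocalStabilityTheorem42 (familySup 2 N hN (Hits.r₁ (2 + 2)) cd X π A hle) := by
  obtain ⟨cd, hcd, N₀, H⟩ := exists_cd_N₀_localStabilityTheorem42_alfIn_of_lemmas L h11 h13
  exact ⟨cd, hcd, N₀, fun N hN hN₀ X π A hle =>
    localStabilityTheorem42_familySup 2 N hN _ cd X π A hle (H N hN hN₀)⟩

/-- **Theorem 4.2 for the four-dimensional comb scheme with print's full `A_{l.f.}(P)`** (`familyFull`: inside shares + the shares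
from any finite set of exterior l.f. plaquettes; every compact `G` with §1 chart data; Lemmas 1.1, 1.3 as hypotheses), `f₁, a₀`
uniform over the exterior set. [cite: Federbush1987PhaseCellIII, Local Stability Theorem 4.2 (4.4) p. 299; §4 p. 298] -/
theorem exists_cd_N₀_localStabilityTheorem42_alfFull_of_lemmas (h11 : Lemma11 L.exp) (h13 : Lemma13 L.exp) :
    ∃ cd : ℝ, 0 < cd ∧ ∃ N₀ : ℕ, ∀ (N : ℕ) (hN : 0 < N), N₀ ≤ N →
      TwoLevelScheme.LocalStabilityTheorem42 (familyFull (G := G) 2 N hN (Hits.r₁ (2 + 2)) cd) := by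
  obtain ⟨cd, hcd, N₀, H⟩ := exists_cd_N₀_localStabilityTheorem42_sup_of_lemmas L h11 h13
  exact ⟨cd, hcd, N₀, fun N hN hN₀ => H N hN hN₀ _ _ _ _⟩

end Sup

section SupInstances

/-- **Model instance `G = U(N)`, every `N`: Theorem 4.2 with print's full `A_{l.f.}(P)`, NO hypothesis, `f₁, a₀` uniform over the
exterior l.f. set.** [cite: Federbush1987PhaseCellIII, Local Stability Theorem 4.2 (4.4) p. 299; §4 p. 298] -/
theorem exists_cd_N₀_localStabilityTheorem42_alfFull_UN {n : ℕ} :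
    ∃ cd : ℝ, 0 < cd ∧ ∃ N₀ : ℕ, ∀ (N : ℕ) (hN : 0 < N), N₀ ≤ N →
      TwoLevelScheme.LocalStabilityTheorem42 (familyFull (G := UN n) 2 N hN (Hits.r₁ (2 + 2)) cd) :=
  exists_cd_N₀_localStabilityTheorem42_alfFull_of_lemmas UN.localLog UN.lemma11_UN UN.lemma13_UN

/-- **Model instance `G = U(N)`, every `N`, every supplemented family** (any configuration space over the four blocks, any l.f.
action `≧ alfIn`), NO hypothesis. [cite: Federbush1987PhaseCellIII, Local Stability Theorem 4.2 (4.4) p. 299; §4 p. 298] -/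
theorem exists_cd_N₀_localStabilityTheorem42_sup_UN {n : ℕ} :
    ∃ cd : ℝ, 0 < cd ∧ ∃ N₀ : ℕ, ∀ (N : ℕ) (hN : 0 < N), N₀ ≤ N →
      ∀ (X : Type) (π : X → Cfg (UN n) 2 N) (A : ℝ → X → ℝ) (hle : ∀ a x, alfIn 2 N hN a (π x) ≤ A a x),
        TwoLevelScheme.LocalStabilityTheorem42 (familySup 2 N hN (Hits.r₁ (2 + 2)) cd X π A hle) :=
  exists_cd_N₀_localStabilityTheorem42_sup_of_lemmas UN.localLog UN.lemma11_UN UN.lemma13_UN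

attribute [local instance] SU2.compactSpace in
/-- **Model instance `G = SU(2)`: Theorem 4.2 with print's full `A_{l.f.}(P)`, NO hypothesis, `f₁, a₀` uniform over the exterior
l.f. set.** [cite: Federbush1987PhaseCellIII, Local Stability Theorem 4.2 (4.4) p. 299; §1 p. 294; §4 p. 298] -/
theorem exists_cd_N₀_localStabilityTheorem42_alfFull_SU2 :
    ∃ cd : ℝ, 0 < cd ∧ ∃ N₀ : ℕ, ∀ (N : ℕ) (hN : 0 < N), N₀ ≤ N →
      TwoLevelScheme.LocalStabilityTheorem42 (familyFull (G := SU2) 2 N hN (Hits.r₁ (2 + 2)) cd) :=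
  exists_cd_N₀_localStabilityTheorem42_alfFull_of_lemmas SU2.localLog SU2.lemma11_SU2 SU2.lemma13_SU2

attribute [local instance] SU2.compactSpace in
/-- **Model instance `G = SU(2)`, every supplemented family**, NO hypothesis. [cite: Federbush1987PhaseCellIII, Local Stability
Theorem 4.2 (4.4) p. 299; §1 p. 294; §4 p. 298] -/
theorem exists_cd_N₀_localStabilityTheorem42_sup_SU2 :
    ∃ cd : ℝ, 0 < cd ∧ ∃ N₀ : ℕ, ∀ (N : ℕ) (hN : 0 < N), N₀ ≤ N →
      ∀ (X : Type) (π : X → Cfg SU2 2 N) (A : ℝ → X → ℝ) (hle : ∀ a x, alfIn 2 N hN a (π x) ≤ A a x),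
        TwoLevelScheme.LocalStabilityTheorem42 (familySup 2 N hN (Hits.r₁ (2 + 2)) cd X π A hle) :=
  exists_cd_N₀_localStabilityTheorem42_sup_of_lemmas SU2.localLog SU2.lemma11_SU2 SU2.lemma13_SU2

/-- **Model instance `G = H`, every closed locally exponential `H ≦ U(N)`: Theorem 4.2 with print's full `A_{l.f.}(P)`, NO
hypothesis.** [cite: Federbush1987PhaseCellIII, Local Stability Theorem 4.2 (4.4) p. 299; p. 294; §4 p. 298] -/
theorem exists_cd_N₀_localStabilityTheorem42_alfFull_H {n : ℕ} (D : UNLieSubgroup n) :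
    ∃ cd : ℝ, 0 < cd ∧ ∃ N₀ : ℕ, ∀ (N : ℕ) (hN : 0 < N), N₀ ≤ N →
      TwoLevelScheme.LocalStabilityTheorem42 (familyFull (G := D.H) 2 N hN (Hits.r₁ (2 + 2)) cd) :=
  exists_cd_N₀_localStabilityTheorem42_alfFull_of_lemmas D.localLog D.lemma11H D.lemma13H

/-- **Model instance `G = SU(N)`, every `N`: Theorem 4.2 with print's full `A_{l.f.}(P)`, NO hypothesis.**
[cite: Federbush1987PhaseCellIII, Local Stability Theorem 4.2 (4.4) p. 299; §4 p. 298] -/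
theorem exists_cd_N₀_localStabilityTheorem42_alfFull_SUN {n : ℕ} :
    ∃ cd : ℝ, 0 < cd ∧ ∃ N₀ : ℕ, ∀ (N : ℕ) (hN : 0 < N), N₀ ≤ N →
      TwoLevelScheme.LocalStabilityTheorem42 (familyFull (G := SUN n) 2 N hN (Hits.r₁ (2 + 2)) cd) :=
  exists_cd_N₀_localStabilityTheorem42_alfFull_H (SUNSubgroup n)

/-- **Model instance `G = H`, `H` ANY closed subgroup of `U(N)`: Theorem 4.2 with print's full `A_{l.f.}(P)`, NO hypothesis.**
[cite: Federbush1987PhaseCellIII, Local Stability Theorem 4.2 (4.4) p. 299; p. 294 «G a compact Lie Group»; §4 p. 298] -/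
theorem exists_cd_N₀_localStabilityTheorem42_alfFull_closed {n : ℕ} (H : Subgroup (UN n))
    (hH : IsClosed (H : Set (UN n))) :
    ∃ cd : ℝ, 0 < cd ∧ ∃ N₀ : ℕ, ∀ (N : ℕ) (hN : 0 < N), N₀ ≤ N →
      TwoLevelScheme.LocalStabilityTheorem42
        (familyFull (G := (UNLieSubgroup.ofClosed H hH).H) 2 N hN (Hits.r₁ (2 + 2)) cd) :=
  exists_cd_N₀_localStabilityTheorem42_alfFull_H (UNLieSubgroup.ofClosed H hH)

end SupInstances

/-! ## §6 (v1.1) «for suitable fixed N, c_d, f₁, f₂, and a₀»: the constants fixed BEFORE the exterior data and the configuration -/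

section Uniform

variable {G : Type} [Group G] [MetricSpace G] [CompactSpace G] [IsIsometricSMul G G] [IsIsometricSMul Gᵐᵒᵖ G]
variable {𝔤 : Type*} [NormedAddCommGroup 𝔤] [InnerProductSpace ℝ 𝔤] (L : LocalLog G 𝔤)

/-- **Theorem 4.2 with ALL constants fixed first** — print's order «All these results will hold for suitable fixed N, c_d, f₁, f₂,
and a₀, where a must satisfy a < a₀» made explicit: `c_d`, then `N ≧ N₀`, then `f₁ > 0` and `a₀ > 0` are chosen BEFORE the
configuration space `X` over the four blocks, the l.f. action `A ≧ alfIn ∘ π` on it, the threshold `a < a₀` and the configuration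
`x` (every compact `G` with §1 chart data; Lemmas 1.1, 1.3 as hypotheses).  This is `exists_cd_N₀_localStabilityTheorem42_sup_of_lemmas`
with the existential quantifiers of `LocalStabilityTheorem42` pulled in front of `∀ X π A`.
[cite: Federbush1987PhaseCellIII, Local Stability Theorem 4.2 (4.4) p. 299; §4 p. 298; §5.3 10) p. 305] -/
theorem exists_uniform_constants_sup_of_lemmas (h11 : Lemma11 L.exp) (h13 : Lemma13 L.exp) :
    ∃ cd : ℝ, 0 < cd ∧ ∃ N₀ : ℕ, ∀ (N : ℕ) (hN : 0 < N), N₀ ≤ N → ∃ f₁ > (0 : ℝ), ∃ a₀ > (0 : ℝ),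
      ∀ (X : Type) (π : X → Cfg G 2 N) (A : ℝ → X → ℝ) (hle : ∀ a x, alfIn 2 N hN a (π x) ≤ A a x),
        ∀ a : ℝ, 0 < a → a < a₀ →
          (familySup 2 N hN (Hits.r₁ (2 + 2)) cd X π A hle a).a = a ∧
            ∀ x : (familySup 2 N hN (Hits.r₁ (2 + 2)) cd X π A hle a).Cfg,
              (familySup 2 N hN (Hits.r₁ (2 + 2)) cd X π A hle a).Regime2 x →
                f₁ * a ^ 2 ≤ (familySup 2 N hN (Hits.r₁ (2 + 2)) cd X π A hle a).deltaStilde x := by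
  obtain ⟨cd, hcd, N₀, H⟩ := exists_cd_N₀_localStabilityTheorem42_alfIn_of_lemmas L h11 h13
  refine ⟨cd, hcd, N₀, fun N hN hN₀ => ?_⟩
  obtain ⟨f₁, hf₁, a₀, ha₀, H'⟩ := H N hN hN₀
  refine ⟨f₁, hf₁, a₀, ha₀, fun X π A hle a ha ha₀ => ?_⟩
  obtain ⟨_, Ha⟩ := H' a ha ha₀
  rw [familyC_of_pos 2 N hN _ cd _ _ ha] at Ha
  rw [familySup_of_pos 2 N hN _ cd X π A hle ha]
  exact ⟨rfl, TwoLevelScheme.regime2_bound_supplement Ha⟩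

/-- **Model instance `G = U(N)`, every `N`: Theorem 4.2 with all constants fixed before the exterior data, NO hypothesis.**
[cite: Federbush1987PhaseCellIII, Local Stability Theorem 4.2 (4.4) p. 299; §4 p. 298] -/
theorem exists_uniform_constants_sup_UN {n : ℕ} :
    ∃ cd : ℝ, 0 < cd ∧ ∃ N₀ : ℕ, ∀ (N : ℕ) (hN : 0 < N), N₀ ≤ N → ∃ f₁ > (0 : ℝ), ∃ a₀ > (0 : ℝ),
      ∀ (X : Type) (π : X → Cfg (UN n) 2 N) (A : ℝ → X → ℝ) (hle : ∀ a x, alfIn 2 N hN a (π x) ≤ A a x),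
        ∀ a : ℝ, 0 < a → a < a₀ →
          (familySup 2 N hN (Hits.r₁ (2 + 2)) cd X π A hle a).a = a ∧
            ∀ x : (familySup 2 N hN (Hits.r₁ (2 + 2)) cd X π A hle a).Cfg,
              (familySup 2 N hN (Hits.r₁ (2 + 2)) cd X π A hle a).Regime2 x →
                f₁ * a ^ 2 ≤ (familySup 2 N hN (Hits.r₁ (2 + 2)) cd X π A hle a).deltaStilde x :=
  exists_uniform_constants_sup_of_lemmas UN.localLog UN.lemma11_UN UN.lemma13_UN

attribute [local instance] SU2.compactSpace in
/-- **Model instance `G = SU(2)`: Theorem 4.2 with all constants fixed before the exterior data, NO hypothesis.**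
[cite: Federbush1987PhaseCellIII, Local Stability Theorem 4.2 (4.4) p. 299; §4 p. 298] -/
theorem exists_uniform_constants_sup_SU2 :
    ∃ cd : ℝ, 0 < cd ∧ ∃ N₀ : ℕ, ∀ (N : ℕ) (hN : 0 < N), N₀ ≤ N → ∃ f₁ > (0 : ℝ), ∃ a₀ > (0 : ℝ),
      ∀ (X : Type) (π : X → Cfg SU2 2 N) (A : ℝ → X → ℝ) (hle : ∀ a x, alfIn 2 N hN a (π x) ≤ A a x),
        ∀ a : ℝ, 0 < a → a < a₀ →
          (familySup 2 N hN (Hits.r₁ (2 + 2)) cd X π A hle a).a = a ∧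
            ∀ x : (familySup 2 N hN (Hits.r₁ (2 + 2)) cd X π A hle a).Cfg,
              (familySup 2 N hN (Hits.r₁ (2 + 2)) cd X π A hle a).Regime2 x →
                f₁ * a ^ 2 ≤ (familySup 2 N hN (Hits.r₁ (2 + 2)) cd X π A hle a).deltaStilde x :=
  exists_uniform_constants_sup_of_lemmas SU2.localLog SU2.lemma11_SU2 SU2.lemma13_SU2

/-- **Model instance `G = H`, `H` ANY closed subgroup of `U(N)`: Theorem 4.2 with all constants fixed before the exterior data, NO
hypothesis.** [cite: Federbush1987PhaseCellIII, Local Stability Theorem 4.2 (4.4) p. 299; p. 294 «G a compact Lie Group»; §4 p. 298] -/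
theorem exists_uniform_constants_sup_closed {n : ℕ} (H : Subgroup (UN n)) (hH : IsClosed (H : Set (UN n))) :
    ∃ cd : ℝ, 0 < cd ∧ ∃ N₀ : ℕ, ∀ (N : ℕ) (hN : 0 < N), N₀ ≤ N → ∃ f₁ > (0 : ℝ), ∃ a₀ > (0 : ℝ),
      ∀ (X : Type) (π : X → Cfg (UNLieSubgroup.ofClosed H hH).H 2 N) (A : ℝ → X → ℝ)
        (hle : ∀ a x, alfIn 2 N hN a (π x) ≤ A a x),
        ∀ a : ℝ, 0 < a → a < a₀ →
          (familySup 2 N hN (Hits.r₁ (2 + 2)) cd X π A hle a).a = a ∧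
            ∀ x : (familySup 2 N hN (Hits.r₁ (2 + 2)) cd X π A hle a).Cfg,
              (familySup 2 N hN (Hits.r₁ (2 + 2)) cd X π A hle a).Regime2 x →
                f₁ * a ^ 2 ≤ (familySup 2 N hN (Hits.r₁ (2 + 2)) cd X π A hle a).deltaStilde x :=
  exists_uniform_constants_sup_of_lemmas (UNLieSubgroup.ofClosed H hH).localLog (UNLieSubgroup.ofClosed H hH).lemma11H
    (UNLieSubgroup.ofClosed H hH).lemma13H

end Uniform

/-! ## §7 (v1.1) «if more than r₁ p_i are l.f., we are in Regime 3» and the Regime-1 transfer, on the comb scheme -/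

section Regime3

variable {G : Type} [Group G] [MetricSpace G] [CompactSpace G] (d N : ℕ) (hN : 0 < N) (r₁ : ℕ)

/-- **«We note there is an absolute number r₁ such that if more than r₁ p_i are l.f., we are in Regime 3»** for the comb scheme with
print's `A_{l.f.}(P)` from the `p_i` (`r₁ = 96(d+2)²`, p32 gen 7's `Hits.regime3_of_card_lf_gt` on the scheme).
[cite: Federbush1987PhaseCellIII, §4 p. 298] -/
theorem regime3_schemeC_alfIn_of_card_lfSet_gt (cd a : ℝ) (ha : 0 < a) (U : Cfg G d N)
    (h : Hits.r₁ (d + 2) < (lfSet d N hN a U).card) :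
    (schemeC d N hN r₁ cd a ha (alfIn d N hN a) (alfIn_nonneg d N hN a)).Regime3 U := by
  classical
  have hall : ((lfSet d N hN a U).image (toHits d N)).filter (Hits.InBlocks N (coarseP d)) =
      (lfSet d N hN a U).image (toHits d N) :=
    Finset.filter_true_of_mem fun p hp => by
      obtain ⟨j, _, rfl⟩ := Finset.mem_image.1 hp
      exact inBlocks_toHits hN j
  have h' : Hits.r₁ (d + 2) < (((lfSet d N hN a U).image (toHits d N)).filter (Hits.InBlocks N (coarseP d))).card := by
    rw [hall, card_image_lfSet]; exact h
  exact Hits.regime3_of_card_lf_gt N a _ _ h'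

/-- The same for every supplemented comb scheme (more l.f. action only deepens Regime 3). [cite: Federbush1987PhaseCellIII, §4 p. 298] -/
theorem regime3_schemeSup_of_card_lfSet_gt (cd a : ℝ) (ha : 0 < a) (X : Type) (π : X → Cfg G d N) (A : X → ℝ)
    (hle : ∀ x, alfIn d N hN a (π x) ≤ A x) (x : X) (h : Hits.r₁ (d + 2) < (lfSet d N hN a (π x)).card) :
    (schemeSup d N hN r₁ cd a ha X π A hle).Regime3 x :=
  TwoLevelScheme.Regime3.supplement (regime3_schemeC_alfIn_of_card_lfSet_gt d N hN r₁ cd a ha (π x) h)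

/-- **Theorem 4.3's statement transfers to every supplemented family** (Regime 1 and the fine sizes are read through `π`, `Δ̃S` only
grows). [cite: Federbush1987PhaseCellIII, Local Stability Theorem 4.3 (4.5) p. 299] -/
theorem localStabilityTheorem43_familySup (cd : ℝ) (X : Type) (π : X → Cfg G d N) (A : ℝ → X → ℝ)
    (hle : ∀ a x, alfIn d N hN a (π x) ≤ A a x)
    (H : TwoLevelScheme.LocalStabilityTheorem43 (familyC d N hN r₁ cd (alfIn (G := G) d N hN) (alfIn_nonneg d N hN))) :
    TwoLevelScheme.LocalStabilityTheorem43 (familySup d N hN r₁ cd X π A hle) := by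
  obtain ⟨f₂, a₀, ha₀, H⟩ := H
  refine ⟨f₂, a₀, ha₀, fun a ha ha₀ => ?_⟩
  obtain ⟨_, Ha⟩ := H a ha ha₀
  rw [familyC_of_pos d N hN r₁ cd _ _ ha] at Ha
  rw [familySup_of_pos d N hN r₁ cd X π A hle ha]
  exact ⟨rfl, TwoLevelScheme.regime1_bound_supplement (B := fun v => -f₂ * (∑ j, v j ^ 2) ^ ((3 : ℝ) / 2)) Ha⟩

end Regime3

/-! ## §8 (v1.1) The share bound in p32 gen 15's `hshare` form (hit number `m = 16(d+2)²` as a natural number) -/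

section ShareForm

variable {G : Type} [Group G] [MetricSpace G] (d N : ℕ) (hN : 0 < N)

/-- The share bound in the form `#lfSet·(a²/(2m)) ≦ A_lf` with the natural number `m = 16(d+2)²` — the hypothesis `hshare` of
p32 gen 15's `exists_cd_N₀_localStabilityTheorem42_of_lfShare` (`Regime2CombSU2` v1.1), so that theorem applies verbatim to
`A_lf := alfIn`. [cite: Federbush1987PhaseCellIII, §4 p. 298] -/
theorem card_lfSet_mul_share_le_alfIn' :
    ∀ a : ℝ, 0 < a → ∀ U : Cfg G d N,
      ((lfSet d N hN a U).card : ℝ) * (a ^ 2 / (2 * ((16 * (d + 2) ^ 2 : ℕ) : ℝ))) ≤ alfIn d N hN a U := by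
  intro a _ U
  have h := card_lfSet_mul_share_le_alfIn d N hN a U
  have he : a ^ 2 / (2 * ((16 * (d + 2) ^ 2 : ℕ) : ℝ)) = (a ^ 2 / 2) / (16 * ((d + 2 : ℕ) : ℝ) ^ 2) := by
    push_cast; field_simp
  rw [he]; exact h

/-- `m = 16(d+2)² ≧ 1`. [cite: Federbush1987PhaseCellIII, §4 p. 298] -/
theorem hitNumber_pos (d : ℕ) : 0 < 16 * (d + 2) ^ 2 := by positivity

end ShareForm

end LocalStabilityG

end

end Literature.MathematicalPhysics.QuantumFieldTheory.Federbush1986
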